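/-
Width seat `ym-line-cbag-p1-w3` (prover-ym-line-cbag-p1-w3-g8-0; own items stmt-QuantumFields-22254 / 22893 CLOSED proved), helping LINE 3
`route-QuantumFields-SixPlaneColdBox` (crux stmt-QuantumFields-25709 `DensityTransferG`): the error budget and the affine / floor
bookkeeping of the six-plane DLR transfer with slack (`SixPlaneColdBoxTransferWithSlack`).
-/
import Summits.QuantumFields.YangMills.Theorems.SixPlaneColdBoxTransferPlumbing

/-!
# Route `SixPlaneColdBox`, crux `DensityTransferG`: the error budget of the transfer with slack

Pure bookkeeping for `SixPlaneColdBox.sixPlaneTransferWithSlack_of_torusMeanNear` (`Theorems/SixPlaneColdBoxTransferWithSlack.lean`):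

* `integral_affine_eq`, `integral_floor_eq` — the torus integrals of the affine excess `β·h − β·E + c` and of the floor
  `c₁·f + c₁·g + c·𝟙_E + c₀` under a probability measure; `abs_affine_le`, `abs_floor_le`, `abs_integral_le_of_abs_le` — their sup bounds;
* `transferBudget` — with `θ = 20A ≤ 1/200`, `0 < m < m₁`, `8m ≤ θ`: eventually in `β`, for every bad mass `p ≤ 6·7⁴·β^{4θ}e^{−β^{θ/5}}` and every
  floor level `0 ≤ θ⁺ ≤ 2C₆²`, the seven error pieces of the transfer (torus-mean defect `β^{−(1+4A+m₁)}`, the `2β^{−1/4}` mean slack, the flat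
  mean smoothness `β^{2θ/5−1}⌈β^A⌉/⌈β^θ⌉`, the bad-mass part of the floor, the covariance slack `2β^{−1/5}`, the squared mean difference, and
  the bad-event term of the law of total covariance) sum to at most `β^{−(8A+m)}`.

No sorry; no definition; standard axioms.  NOT a claim about the Yang–Mills mass gap.
-/

set_option autoImplicit false

noncomputable section

open MeasureTheory Finset Real Filter Topology
open Summit.QuantumFields.YangMills.Theorems.WeakCouplingRates

namespace Summit.QuantumFields.YangMills.Theorems.SixPlaneColdBox

/-! ## Affine and floor bookkeeping under a probability measure -/

/-- `∫ (β·h − β·E + c) = β·(∫h − E) + c` under a probability measure. -/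
theorem integral_affine_eq {Ω : Type*} [MeasurableSpace Ω] (μ : Measure Ω) [IsProbabilityMeasure μ] {h : Ω → ℝ}
    (hh : Integrable h μ) (β E c : ℝ) : ∫ U, (β * h U - β * E + c) ∂μ = β * ((∫ U, h U ∂μ) - E) + c := by
  have i1 : Integrable (fun U => β * h U - β * E) μ := (hh.const_mul β).sub (integrable_const _)
  have i2 : Integrable (fun U => β * h U) μ := hh.const_mul β
  rw [integral_add i1 (integrable_const _), integral_sub i2 (integrable_const _), integral_const_mul, integral_const, integral_const,
    smul_eq_mul, smul_eq_mul, probReal_univ, one_mul, one_mul]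
  ring

/-- `∫ (c₁·f + c₁·g + c·𝟙_E + c₀) = c₁∫f + c₁∫g + c·μ(E) + c₀` under a probability measure. -/
theorem integral_floor_eq {Ω : Type*} [MeasurableSpace Ω] (μ : Measure Ω) [IsProbabilityMeasure μ] {f g : Ω → ℝ}
    (hf : Integrable f μ) (hg : Integrable g μ) {E : Set Ω} (hE : MeasurableSet E) (c₁ c c₀ : ℝ) :
    ∫ U, (c₁ * f U + c₁ * g U + c * E.indicator (fun _ => (1 : ℝ)) U + c₀) ∂μ =
      c₁ * (∫ U, f U ∂μ) + c₁ * (∫ U, g U ∂μ) + c * μ.real E + c₀ := by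
  have hindi : Integrable (fun U => E.indicator (fun _ => (1 : ℝ)) U) μ := (integrable_const 1).indicator hE
  have i3 : Integrable (fun U => c₁ * f U + c₁ * g U + c * E.indicator (fun _ => (1 : ℝ)) U) μ :=
    ((hf.const_mul c₁).add (hg.const_mul c₁)).add (hindi.const_mul _)
  have i2 : Integrable (fun U => c₁ * f U + c₁ * g U) μ := (hf.const_mul c₁).add (hg.const_mul c₁)
  have i1a : Integrable (fun U => c₁ * f U) μ := hf.const_mul c₁
  have i1b : Integrable (fun U => c₁ * g U) μ := hg.const_mul c₁
  have i1c : Integrable (fun U => c * E.indicator (fun _ => (1 : ℝ)) U) μ := hindi.const_mul _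
  rw [integral_add i3 (integrable_const _), integral_add i2 i1c, integral_add i1a i1b, integral_const_mul, integral_const_mul,
    integral_const_mul, integral_indicator_const (1 : ℝ) hE, integral_const, smul_eq_mul, smul_eq_mul, probReal_univ, one_mul, mul_one]

/-- The mean of a function bounded by `C` in absolute value is bounded by `C` (probability measure). -/
theorem abs_integral_le_of_abs_le {Ω : Type*} [MeasurableSpace Ω] (μ : Measure Ω) [IsProbabilityMeasure μ] {f : Ω → ℝ} {C : ℝ}
    (hf : ∀ x, |f x| ≤ C) : |∫ x, f x ∂μ| ≤ C := by
  have h := norm_integral_le_of_norm_le_const (μ := μ) (f := f) (C := C) (ae_of_all _ fun W => by simpa [Real.norm_eq_abs] using hf W)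
  simpa [Real.norm_eq_abs] using h

/-- `|β·x − β·E + c| ≤ βC + βC + c_max` for `|x|, |E| ≤ C`, `0 ≤ c ≤ c_max`, `0 ≤ β`. -/
theorem abs_affine_le {x E C c cmax β : ℝ} (hx : |x| ≤ C) (hE : |E| ≤ C) (hc0 : 0 ≤ c) (hc : c ≤ cmax) (hβ : 0 ≤ β) :
    |β * x - β * E + c| ≤ β * C + β * C + cmax := by
  rw [abs_le] at hx hE ⊢
  have h1 : 0 ≤ β * (C - x) := mul_nonneg hβ (by linarith [hx.2])
  have h2 : 0 ≤ β * (C + x) := mul_nonneg hβ (by linarith [hx.1])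
  have h3 : 0 ≤ β * (C - E) := mul_nonneg hβ (by linarith [hE.2])
  have h4 : 0 ≤ β * (C + E) := mul_nonneg hβ (by linarith [hE.1])
  constructor <;> nlinarith [h1, h2, h3, h4]

/-- `|c₁·(a⁺ + b⁺) + c₀| ≤ c₁(C + C) + |c₀|` for `|a|, |b| ≤ C`, `0 ≤ c₁`. -/
theorem abs_floor_le {a b C c₁ c₀ : ℝ} (ha : |a| ≤ C) (hb : |b| ≤ C) (hc₁ : 0 ≤ c₁) :
    |c₁ * (max a 0 + max b 0) + c₀| ≤ c₁ * (C + C) + |c₀| := by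
  have habsmax : ∀ x : ℝ, |x| ≤ C → |max x 0| ≤ C := fun x hx => by
    rw [abs_le] at hx ⊢
    exact ⟨by linarith [le_max_right x 0, hx.1, hx.2], max_le hx.2 (by linarith [hx.1, hx.2])⟩
  calc |c₁ * (max a 0 + max b 0) + c₀| ≤ |c₁ * (max a 0 + max b 0)| + |c₀| := abs_add_le _ _
    _ ≤ c₁ * (C + C) + |c₀| := by
        rw [abs_mul, abs_of_nonneg hc₁]
        gcongr
        exact (abs_add_le _ _).trans (add_le_add (habsmax a ha) (habsmax b hb))

/-! ## The error budget -/

/-- **The error budget of the transfer with slack.**  With `θ = 20A ≤ 1/200`, `0 < m < m₁`, `8m ≤ θ` and nonnegative constants, eventually in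
`β`: for every `0 ≤ p ≤ 6·2401·β^{4θ}e^{−β^{θ/5}}` and `0 ≤ θ⁺ ≤ 2C₆²` the seven error pieces sum to at most `β^{−(8A+m)}`. -/
theorem transferBudget {A θ m m₁ K cP SKf Ks C₆ : ℝ} (hA : 0 < A) (hA20 : 20 * A = θ) (hm : 0 < m) (hmm₁ : m < m₁) (hmθ : 8 * m ≤ θ)
    (hθ2 : θ ≤ 1 / 200) (hK : 0 ≤ K) (hcP : 0 ≤ cP) (hSKf : 0 ≤ SKf) (hKs : 0 ≤ Ks) (hC₆ : 0 ≤ C₆) :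
    ∀ᶠ β : ℝ in atTop, ∀ p θp : ℝ, 0 ≤ p → p ≤ 6 * 2401 * (β ^ (4 * θ) * Real.exp (-(β ^ (θ / 5)))) → 0 ≤ θp →
      θp ≤ 2 * C₆ ^ 2 →
        K * β ^ (-(4 * A)) * cP * (β * (cP * β ^ (-(1 + 4 * A + m₁)))) * 2 +
              K * β ^ (-(4 * A)) * cP * (cP * (2 * β ^ (-(1 / 4 : ℝ)))) * 2 +
              K * β ^ (-(4 * A)) * cP * (β * (SKf * (β ^ (2 * (θ / 5) - 1) * (⌈β ^ A⌉₊ : ℝ) / (⌈β ^ θ⌉₊ : ℝ)))) +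
              K * β ^ (-(4 * A)) * cP * (2 * (β * C₆ + β * C₆ + cP * 2)) * p +
            cP ^ 2 * (2 * β ^ (-(1 / 5 : ℝ))) +
            β ^ 2 * ((Ks * β ^ (2 * (θ / 5) - 1) * (⌈β ^ A⌉₊ : ℝ) / (⌈β ^ θ⌉₊ : ℝ)) ^ 2 / 4) +
            β ^ 2 * ((θp + 3 * C₆ ^ 2) * p) ≤ β ^ (-(8 * A + m)) := by
  have hθ : 0 < θ := by linarith
  have hδ : (0 : ℝ) < θ / 5 := by positivity
  have hgapA : -(8 * A + m₁) < -(8 * A + m) := by linarith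
  have hgapB : -(4 * A) + -(1 / 4 : ℝ) < -(8 * A + m) := by linarith
  have hgapC : -(4 * A) + 2 * (θ / 5) + A - θ < -(8 * A + m) := by linarith
  have hgapD : -(1 / 5 : ℝ) < -(8 * A + m) := by linarith
  have hgapE : 2 * (2 * (θ / 5) - 1 + A - θ) + 2 < -(8 * A + m) := by linarith
  have h8 : (0 : ℝ) < 8 := by norm_num
  filter_upwards [eventually_const_rpow_le_rpow_div (C := K * cP * (2 * cP)) hgapA h8,
    eventually_const_rpow_le_rpow_div (C := K * cP * (4 * cP)) hgapB h8,
    eventually_const_rpow_le_rpow_div (C := K * cP * (2 * SKf)) hgapC h8,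
    eventually_const_rpow_le_rpow_div (C := cP ^ 2 * 2) hgapD h8,
    eventually_const_rpow_le_rpow_div (C := Ks ^ 2) hgapE h8,
    eventually_const_rpow_exp_le_rpow_div (C := K * cP * (2 * (2 * (2 * C₆ + 2 * cP))) * (6 * 2401))
      (s := -(4 * A) + 1 + 4 * θ) (b := -(8 * A + m)) hδ h8,
    eventually_const_rpow_exp_le_rpow_div (C := (5 * C₆ ^ 2) * (6 * 2401)) (s := 2 + 4 * θ) (b := -(8 * A + m)) hδ h8,
    eventually_ge_atTop (1 : ℝ)] with β e1 e2 e3 e4 e5 e6 e7 hβ1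
  intro p θp hp0 hp_le hθp0 hθpK
  have hβ0 : 0 < β := by linarith
  have hTH : (⌈β ^ A⌉₊ : ℝ) / (⌈β ^ θ⌉₊ : ℝ) ≤ 2 * β ^ (A - θ) := ceil_div_ceil_le_rpow hβ1 hA.le
  have hTH0 : 0 ≤ (⌈β ^ A⌉₊ : ℝ) / (⌈β ^ θ⌉₊ : ℝ) := by positivity
  have hP1 : K * β ^ (-(4 * A)) * cP * (β * (cP * β ^ (-(1 + 4 * A + m₁)))) * 2 ≤ β ^ (-(8 * A + m)) / 8 := by
    have epow : β ^ (-(4 * A)) * (β * β ^ (-(1 + 4 * A + m₁))) = β ^ (-(8 * A + m₁)) := by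
      rw [← Real.rpow_one_add' hβ0.le (by linarith : (1 : ℝ) + -(1 + 4 * A + m₁) ≠ 0), ← Real.rpow_add hβ0]; ring_nf
    calc K * β ^ (-(4 * A)) * cP * (β * (cP * β ^ (-(1 + 4 * A + m₁)))) * 2
        = (K * cP * (2 * cP)) * (β ^ (-(4 * A)) * (β * β ^ (-(1 + 4 * A + m₁)))) := by ring
      _ = (K * cP * (2 * cP)) * β ^ (-(8 * A + m₁)) := by rw [epow]
      _ ≤ β ^ (-(8 * A + m)) / 8 := e1
  have hP2 : K * β ^ (-(4 * A)) * cP * (cP * (2 * β ^ (-(1 / 4 : ℝ)))) * 2 ≤ β ^ (-(8 * A + m)) / 8 := by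
    calc K * β ^ (-(4 * A)) * cP * (cP * (2 * β ^ (-(1 / 4 : ℝ)))) * 2
        = (K * cP * (4 * cP)) * (β ^ (-(4 * A)) * β ^ (-(1 / 4 : ℝ))) := by ring
      _ = (K * cP * (4 * cP)) * β ^ (-(4 * A) + -(1 / 4 : ℝ)) := by rw [← Real.rpow_add hβ0]
      _ ≤ β ^ (-(8 * A + m)) / 8 := e2
  have hP3 : K * β ^ (-(4 * A)) * cP * (β * (SKf * (β ^ (2 * (θ / 5) - 1) * (⌈β ^ A⌉₊ : ℝ) / (⌈β ^ θ⌉₊ : ℝ)))) ≤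
      β ^ (-(8 * A + m)) / 8 := by
    have h1 : β * (β ^ (2 * (θ / 5) - 1) * (⌈β ^ A⌉₊ : ℝ) / (⌈β ^ θ⌉₊ : ℝ)) ≤ 2 * β ^ (2 * (θ / 5) + A - θ) := by
      have epow : β * β ^ (2 * (θ / 5) - 1) = β ^ (2 * (θ / 5)) := by
        rw [← Real.rpow_one_add' hβ0.le (by linarith : (1 : ℝ) + (2 * (θ / 5) - 1) ≠ 0)]; ring_nf
      have e : β * (β ^ (2 * (θ / 5) - 1) * (⌈β ^ A⌉₊ : ℝ) / (⌈β ^ θ⌉₊ : ℝ)) =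
          β ^ (2 * (θ / 5)) * ((⌈β ^ A⌉₊ : ℝ) / (⌈β ^ θ⌉₊ : ℝ)) := by rw [← epow]; ring
      have e2' : 2 * β ^ (2 * (θ / 5) + A - θ) = β ^ (2 * (θ / 5)) * (2 * β ^ (A - θ)) := by
        rw [show 2 * (θ / 5) + A - θ = 2 * (θ / 5) + (A - θ) by ring, Real.rpow_add hβ0]; ring
      rw [e, e2']
      exact mul_le_mul_of_nonneg_left hTH (by positivity)
    calc K * β ^ (-(4 * A)) * cP * (β * (SKf * (β ^ (2 * (θ / 5) - 1) * (⌈β ^ A⌉₊ : ℝ) / (⌈β ^ θ⌉₊ : ℝ))))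
        = K * β ^ (-(4 * A)) * cP * SKf * (β * (β ^ (2 * (θ / 5) - 1) * (⌈β ^ A⌉₊ : ℝ) / (⌈β ^ θ⌉₊ : ℝ))) := by ring
      _ ≤ K * β ^ (-(4 * A)) * cP * SKf * (2 * β ^ (2 * (θ / 5) + A - θ)) := mul_le_mul_of_nonneg_left h1 (by positivity)
      _ = (K * cP * (2 * SKf)) * (β ^ (-(4 * A)) * β ^ (2 * (θ / 5) + A - θ)) := by ring
      _ = (K * cP * (2 * SKf)) * β ^ (-(4 * A) + 2 * (θ / 5) + A - θ) := by
          rw [← Real.rpow_add hβ0]; ring_nf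
      _ ≤ β ^ (-(8 * A + m)) / 8 := e3
  have hP4 : cP ^ 2 * (2 * β ^ (-(1 / 5 : ℝ))) ≤ β ^ (-(8 * A + m)) / 8 := by
    calc cP ^ 2 * (2 * β ^ (-(1 / 5 : ℝ))) = (cP ^ 2 * 2) * β ^ (-(1 / 5 : ℝ)) := by ring
      _ ≤ β ^ (-(8 * A + m)) / 8 := e4
  have hP5 : β ^ 2 * ((Ks * β ^ (2 * (θ / 5) - 1) * (⌈β ^ A⌉₊ : ℝ) / (⌈β ^ θ⌉₊ : ℝ)) ^ 2 / 4) ≤ β ^ (-(8 * A + m)) / 8 := by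
    set x : ℝ := β ^ (2 * (θ / 5) - 1 + A - θ) with hx
    have hx0 : 0 ≤ x := by positivity
    have h1 : Ks * β ^ (2 * (θ / 5) - 1) * (⌈β ^ A⌉₊ : ℝ) / (⌈β ^ θ⌉₊ : ℝ) ≤ 2 * Ks * x := by
      have e : Ks * β ^ (2 * (θ / 5) - 1) * (⌈β ^ A⌉₊ : ℝ) / (⌈β ^ θ⌉₊ : ℝ) =
          Ks * β ^ (2 * (θ / 5) - 1) * ((⌈β ^ A⌉₊ : ℝ) / (⌈β ^ θ⌉₊ : ℝ)) := by ring
      have ex : x = β ^ (2 * (θ / 5) - 1) * β ^ (A - θ) := by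
        rw [hx, show 2 * (θ / 5) - 1 + A - θ = (2 * (θ / 5) - 1) + (A - θ) by ring, Real.rpow_add hβ0]
      rw [e, ex]
      calc Ks * β ^ (2 * (θ / 5) - 1) * ((⌈β ^ A⌉₊ : ℝ) / (⌈β ^ θ⌉₊ : ℝ)) ≤ Ks * β ^ (2 * (θ / 5) - 1) * (2 * β ^ (A - θ)) :=
            mul_le_mul_of_nonneg_left hTH (by positivity)
        _ = 2 * Ks * (β ^ (2 * (θ / 5) - 1) * β ^ (A - θ)) := by ring
    have h0 : 0 ≤ Ks * β ^ (2 * (θ / 5) - 1) * (⌈β ^ A⌉₊ : ℝ) / (⌈β ^ θ⌉₊ : ℝ) := by positivity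
    have h2 : (Ks * β ^ (2 * (θ / 5) - 1) * (⌈β ^ A⌉₊ : ℝ) / (⌈β ^ θ⌉₊ : ℝ)) ^ 2 ≤ (2 * Ks * x) ^ 2 := pow_le_pow_left₀ h0 h1 2
    have hx2 : β ^ 2 * x ^ 2 = β ^ (2 * (2 * (θ / 5) - 1 + A - θ) + 2) := by
      rw [hx, ← Real.rpow_natCast (β ^ (2 * (θ / 5) - 1 + A - θ)) 2, ← Real.rpow_mul hβ0.le, ← Real.rpow_natCast β 2,
        ← Real.rpow_add hβ0]
      norm_num; ring_nf
    calc β ^ 2 * ((Ks * β ^ (2 * (θ / 5) - 1) * (⌈β ^ A⌉₊ : ℝ) / (⌈β ^ θ⌉₊ : ℝ)) ^ 2 / 4) ≤ β ^ 2 * ((2 * Ks * x) ^ 2 / 4) := by gcongr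
      _ = Ks ^ 2 * (β ^ 2 * x ^ 2) := by ring
      _ = Ks ^ 2 * β ^ (2 * (2 * (θ / 5) - 1 + A - θ) + 2) := by rw [hx2]
      _ ≤ β ^ (-(8 * A + m)) / 8 := e5
  have hP6 : K * β ^ (-(4 * A)) * cP * (2 * (β * C₆ + β * C₆ + cP * 2)) * p * 2 ≤ β ^ (-(8 * A + m)) / 8 := by
    have hCMle : β * C₆ + β * C₆ + cP * 2 ≤ (2 * C₆ + 2 * cP) * β := by
      have h1 : cP * 2 * 1 ≤ cP * 2 * β := mul_le_mul_of_nonneg_left hβ1 (by positivity)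
      linarith
    have hCM0 : 0 ≤ β * C₆ + β * C₆ + cP * 2 := by positivity
    have h4A : β ^ (-(4 * A)) * β * β ^ (4 * θ) = β ^ (-(4 * A) + 1 + 4 * θ) := by
      rw [Real.rpow_add hβ0, Real.rpow_add hβ0, Real.rpow_one]
    calc K * β ^ (-(4 * A)) * cP * (2 * (β * C₆ + β * C₆ + cP * 2)) * p * 2
        ≤ K * β ^ (-(4 * A)) * cP * (2 * ((2 * C₆ + 2 * cP) * β)) * (6 * 2401 * (β ^ (4 * θ) * Real.exp (-(β ^ (θ / 5))))) * 2 := by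
          gcongr
      _ = (K * cP * (2 * (2 * (2 * C₆ + 2 * cP))) * (6 * 2401)) *
            ((β ^ (-(4 * A)) * β * β ^ (4 * θ)) * Real.exp (-(β ^ (θ / 5)))) := by ring
      _ = (K * cP * (2 * (2 * (2 * C₆ + 2 * cP))) * (6 * 2401)) * (β ^ (-(4 * A) + 1 + 4 * θ) * Real.exp (-(β ^ (θ / 5)))) := by
          rw [h4A]
      _ ≤ β ^ (-(8 * A + m)) / 8 := e6
  have hP6' : K * β ^ (-(4 * A)) * cP * (2 * (β * C₆ + β * C₆ + cP * 2)) * p ≤ β ^ (-(8 * A + m)) / 8 := by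
    have : 0 ≤ K * β ^ (-(4 * A)) * cP * (2 * (β * C₆ + β * C₆ + cP * 2)) * p := by positivity
    linarith only [hP6, this]
  have hP7 : β ^ 2 * ((θp + 3 * C₆ ^ 2) * p) ≤ β ^ (-(8 * A + m)) / 8 := by
    have e2' : β ^ 2 * β ^ (4 * θ) = β ^ (2 + 4 * θ) := by
      rw [← Real.rpow_natCast β 2, ← Real.rpow_add hβ0]; norm_num
    calc β ^ 2 * ((θp + 3 * C₆ ^ 2) * p) ≤ β ^ 2 * ((5 * C₆ ^ 2) * (6 * 2401 * (β ^ (4 * θ) * Real.exp (-(β ^ (θ / 5)))))) := by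
          gcongr
          linarith
      _ = (5 * C₆ ^ 2) * (6 * 2401) * ((β ^ 2 * β ^ (4 * θ)) * Real.exp (-(β ^ (θ / 5)))) := by ring
      _ = (5 * C₆ ^ 2) * (6 * 2401) * (β ^ (2 + 4 * θ) * Real.exp (-(β ^ (θ / 5)))) := by rw [e2']
      _ ≤ β ^ (-(8 * A + m)) / 8 := e7
  have hX0 : 0 ≤ β ^ (-(8 * A + m)) := by positivity
  linarith only [hP1, hP2, hP3, hP4, hP5, hP6', hP7, hX0]

end Summit.QuantumFields.YangMills.Theorems.SixPlaneColdBox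

end
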